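import Mathlib.Algebra.Group.Subgroup.Basic
import Mathlib.GroupTheory.GroupAction.Basic

/-!
# Exact membership in `K^×·∂(F^×)` by cube roots — the algebra of SEL3ALT design route (c)
# (cell `b2b-bsdres`, CLASS-CLOSURE instrument builder 4 = seat cc-eng-4, GEN 94; tool file)

HONEST FRAMING (cell `b2b-bsdres`, run/shared/lean/b2b/bsd-rank1-residual/, verbatim in every
file): the goal of the cell is to DELETE the COMBINATION-SHAPED residual classes of the
Birch–Swinnerton-Dyer formula for ALL analytic-rank `≤ 1` elliptic curves over `ℚ` — "full BSD
formula for every rank `≤ 1` curve in class `C`" assembled STRICTLY from published theorems — so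
that the rank-`≤ 1` remainder becomes exactly the CONSTRUCTION-SHAPED classes, which are TYPED
(missing-input `Prop`s), NOT attempted. This is not "finishing BSD". THIS FILE is a class-free TOOL
file: three lines of commutative-group algebra that are the whole mathematical content of design
route (c) of `class-closure/eng-4/b1/stage/DESIGN-034-kvis-probe.md` §5 (instrument B-1
`SEL3ALT`, planned 0.3.4): deciding membership of a local class in `K_v^× · ∂(F_v^×)` EXACTLY by a
cube-root extraction instead of through truncated discrete-log coordinates. Abstract setting:
commutative groups `A` ("`K_v^×`"), `F` ("`F_v^×`"), `H` ("`H₂,v^×`"), homomorphisms `ιF : A → F`,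
`ιH : A → H` (the structure maps) and `d : F → H` ("`∂₂ = N_{M/H₂}`") with the one axiom
`d (ιF b) = (ιH b)^3` (Creutz, *Second p-descents*, Math. Comp. 83 (2014), §6: `∂₂` of a constant
is its cube since `[M : H₂] = 3`). An element `u = (u₁, u₂) ∈ F × H` "is in `K^×∂(F^×)`" iff
`∃ a f, u₁ = ιF a * f^3 ∧ u₂ = ιH a * d f`. NOT a Literature fact, NOT a class theorem; closes no
item, books nothing. THEOREMS ONLY (no definition, no `sorry`).

* `eta_pow_three` — if `u ∈ K^×∂(F^×)` and `(a₀, f₀)` is ANY pair with `u₁ = ιF a₀ * f₀^3`, then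
  `η := u₂ / (ιH a₀ * d f₀)` satisfies `η^3 = 1` (so a non-cube-root-of-unity `η` refutes membership
  at residue precision).
* `mem_iff_eta` — with such `(a₀, f₀)` fixed, `u ∈ K^×∂(F^×) ↔ ∃ b g, g^3 = ιF b ∧ η = (ιH b)⁻¹ * d g`
  (the finite set `T_v` of the design note: the classes `b ∈ A` that become cubes in `F`).
-/

namespace Summit.BirchSwinnertonDyer.Rank1Residual.SecondDescent.CubeRootMembership

variable {A F H : Type*} [CommGroup A] [CommGroup F] [CommGroup H]
  (ιF : A →* F) (ιH : A →* H) (d : F →* H)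

/-- If `ιF a * f^3 = ιF a₀ * f₀^3` then `(f / f₀)^3 = ιF (a₀ / a)`. -/
theorem div_pow_three_eq {a a₀ : A} {f f₀ : F} (e : ιF a * f ^ 3 = ιF a₀ * f₀ ^ 3) :
    (f / f₀) ^ 3 = ιF (a₀ / a) := by
  rw [map_div, div_pow, div_eq_div_iff_mul_eq_mul]
  calc f ^ 3 * ιF a = ιF a * f ^ 3 := mul_comm _ _
    _ = ιF a₀ * f₀ ^ 3 := e

/-- The normalised quotient `η` in product form. -/
theorem eta_eq {a a₀ : A} {f f₀ : F} :
    ιH a * d f / (ιH a₀ * d f₀) = ιH (a / a₀) * d (f / f₀) := by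
  rw [map_div, map_div, div_mul_div_comm]

/-- **`η³ = 1`.** If `u₁ = ιF a * f^3`, `u₂ = ιH a * d f` (membership witness) and also
`u₁ = ιF a₀ * f₀^3` (any cube-root normalisation), then `η = u₂ / (ιH a₀ * d f₀)` cubes to `1`,
provided `d (ιF b) = (ιH b)^3` for all scalars `b`. -/
theorem eta_pow_three (hd : ∀ b : A, d (ιF b) = (ιH b) ^ 3)
    {u₁ : F} {u₂ : H} {a a₀ : A} {f f₀ : F}
    (h₁ : u₁ = ιF a * f ^ 3) (h₂ : u₂ = ιH a * d f) (h₀ : u₁ = ιF a₀ * f₀ ^ 3) :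
    (u₂ / (ιH a₀ * d f₀)) ^ 3 = 1 := by
  have hq : (f / f₀) ^ 3 = ιF (a₀ / a) := div_pow_three_eq ιF (h₁.symm.trans h₀)
  have hd3 : d (f / f₀) ^ 3 = ιH (a₀ / a) ^ 3 := by rw [← map_pow, hq, hd]
  have h1 : a / a₀ * (a₀ / a) = 1 := by simp [div_eq_mul_inv, mul_assoc]
  rw [h₂, eta_eq ιH d, mul_pow, hd3, ← mul_pow, ← map_mul, h1, map_one, one_pow]

/-- **Exact membership criterion.** Fix any `(a₀, f₀)` with `u₁ = ιF a₀ * f₀^3` and put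
`η = u₂ / (ιH a₀ * d f₀)`. Then `u = (u₁, u₂)` has a membership witness `(a, f)`
(`u₁ = ιF a * f^3`, `u₂ = ιH a * d f`) iff `η = (ιH b)⁻¹ * d g` for some `b : A`, `g : F` with
`g^3 = ιF b` — the finite set `T_v` of the design note (the scalar classes that become cubes). -/
theorem mem_iff_eta {u₁ : F} {u₂ : H} {a₀ : A} {f₀ : F} (h₀ : u₁ = ιF a₀ * f₀ ^ 3) :
    (∃ a f, u₁ = ιF a * f ^ 3 ∧ u₂ = ιH a * d f) ↔
      ∃ b g, g ^ 3 = ιF b ∧ u₂ / (ιH a₀ * d f₀) = (ιH b)⁻¹ * d g := by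
  constructor
  · rintro ⟨a, f, h₁, h₂⟩
    refine ⟨a₀ / a, f / f₀, div_pow_three_eq ιF (h₁.symm.trans h₀), ?_⟩
    rw [h₂, eta_eq ιH d, map_div ιH a₀ a, inv_div, ← map_div]
  · rintro ⟨b, g, hg, hη⟩
    refine ⟨a₀ / b, f₀ * g, ?_, ?_⟩
    · rw [h₀, map_div, mul_pow, hg, mul_comm (f₀ ^ 3) (ιF b), ← mul_assoc, div_mul_cancel]
    · have e : u₂ = (ιH b)⁻¹ * d g * (ιH a₀ * d f₀) := by rw [← hη, div_mul_cancel]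
      rw [e, map_div, map_mul]
      simp only [div_eq_mul_inv]
      simp only [mul_comm, mul_left_comm, mul_assoc]

/-!
## Appendix (cc-eng-4 GEN 95, 2026-08-23): the algebra behind the implementation rules of
`SEL3ALT-0.3.4c-dev` (eng-exactrec-1 gen 58 DESIGN READ of route (c), engines/REQUESTS L2947)

* `eta_pow_three_of_rel` — exactrec's sharpening (their `tools-g58/EtaRel.lean`, re-proved here so
  that it lives in the tree): `η³ = 1` holds for EVERY consistent pair (`d u₁ = u₂³`), member or
  not, so in the instrument the test "`η̄³ ≠ 1`" is an ASSERT (precision / bookkeeping slip ⇒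
  INCONCLUSIVE), never an OUT verdict (should-fix S-1).
* `tmem_one`, `tmem_mul`, `tmem_inv`, `tmem_pow_three` — the set
  `T = {η | ∃ b g, g³ = ιF b ∧ η = (ιH b)⁻¹ * d g}` is a subgroup of `H` all of whose elements cube
  to `1` (observation O-1: store ONE `𝔽₃`-subspace of residue patterns; O-3(a): every tabulated
  pattern cubes to `1`).
* `eta_div_eta_tmem` — two cube-root normalisations of the same `u₁` give `η`'s differing by an
  element of `T` (O-2: the verdict is independent of the admissible choice `(a₀, f₀)`).
* `cube_mem_of_rel` — `u³ ∈ K^×∂(F^×)` for every consistent `u` (the quotient has exponent `3`, so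
  exponents `e ∈ 𝔽₃^{d_v}` exhaust the coset search).
Instrument soundness bookkeeping only; closes nothing, books nothing.
-/

/-- **S-1 (exactrec gen 58).** For every CONSISTENT pair — `d u₁ = u₂ ^ 3`, member of
`K^×∂(F^×)` or not — and any cube-root normalisation `u₁ = ιF a₀ * f₀ ^ 3`, the quotient
`η = u₂ / (ιH a₀ * d f₀)` cubes to `1`. -/
theorem eta_pow_three_of_rel (hd : ∀ b : A, d (ιF b) = (ιH b) ^ 3)
    {u₁ : F} {u₂ : H} {a₀ : A} {f₀ : F}
    (hrel : d u₁ = u₂ ^ 3) (h₀ : u₁ = ιF a₀ * f₀ ^ 3) :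
    (u₂ / (ιH a₀ * d f₀)) ^ 3 = 1 := by
  rw [div_pow, mul_pow, ← hd, ← map_pow, ← map_mul, ← h₀, hrel, div_self']

/-- `1 ∈ T` (witness `b = 1`, `g = 1`). -/
theorem tmem_one : ∃ (b : A) (g : F), g ^ 3 = ιF b ∧ (1 : H) = (ιH b)⁻¹ * d g :=
  ⟨1, 1, by rw [one_pow, map_one], by rw [map_one, map_one, inv_one, mul_one]⟩

/-- `T` is closed under multiplication (witness `(b₁ b₂, g₁ g₂)`). -/
theorem tmem_mul {η₁ η₂ : H} {b₁ b₂ : A} {g₁ g₂ : F}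
    (hg₁ : g₁ ^ 3 = ιF b₁) (hη₁ : η₁ = (ιH b₁)⁻¹ * d g₁)
    (hg₂ : g₂ ^ 3 = ιF b₂) (hη₂ : η₂ = (ιH b₂)⁻¹ * d g₂) :
    ∃ (b : A) (g : F), g ^ 3 = ιF b ∧ η₁ * η₂ = (ιH b)⁻¹ * d g := by
  refine ⟨b₁ * b₂, g₁ * g₂, by rw [mul_pow, hg₁, hg₂, map_mul], ?_⟩
  rw [hη₁, hη₂, map_mul, map_mul, mul_inv]
  simp only [mul_comm, mul_left_comm, mul_assoc]

/-- `T` is closed under inverses (witness `(b⁻¹, g⁻¹)`). -/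
theorem tmem_inv {η : H} {b : A} {g : F} (hg : g ^ 3 = ιF b) (hη : η = (ιH b)⁻¹ * d g) :
    ∃ (b' : A) (g' : F), g' ^ 3 = ιF b' ∧ η⁻¹ = (ιH b')⁻¹ * d g' :=
  ⟨b⁻¹, g⁻¹, by rw [inv_pow, hg, map_inv], by simp only [hη, mul_inv, inv_inv, map_inv]⟩

/-- **O-3(a).** Every element of `T` cubes to `1`. -/
theorem tmem_pow_three (hd : ∀ b : A, d (ιF b) = (ιH b) ^ 3)
    {η : H} {b : A} {g : F} (hg : g ^ 3 = ιF b) (hη : η = (ιH b)⁻¹ * d g) : η ^ 3 = 1 := by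
  rw [hη, mul_pow, ← map_pow, hg, hd, inv_pow, inv_mul_cancel]

/-- **O-2 (choice independence).** Two cube-root normalisations `u₁ = ιF a₀ * f₀ ^ 3 = ιF a₁ * f₁ ^ 3`
give quotients `η₀ = u₂ / (ιH a₀ * d f₀)`, `η₁ = u₂ / (ιH a₁ * d f₁)` with `η₀ / η₁ ∈ T`
(witness `b = a₀ / a₁`, `g = f₁ / f₀`), so `η₀ ∈ T ↔ η₁ ∈ T` by `tmem_mul` / `tmem_inv`. -/
theorem eta_div_eta_tmem {u₁ : F} (u₂ : H) {a₀ a₁ : A} {f₀ f₁ : F}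
    (h₀ : u₁ = ιF a₀ * f₀ ^ 3) (h₁ : u₁ = ιF a₁ * f₁ ^ 3) :
    ∃ (b : A) (g : F), g ^ 3 = ιF b ∧
      u₂ / (ιH a₀ * d f₀) / (u₂ / (ιH a₁ * d f₁)) = (ιH b)⁻¹ * d g := by
  refine ⟨a₀ / a₁, f₁ / f₀, div_pow_three_eq ιF (h₁.symm.trans h₀), ?_⟩
  rw [div_div_div_cancel_left, eta_eq ιH d, map_div ιH a₀ a₁, inv_div, ← map_div ιH]

/-- **Exponent 3.** For every consistent `u` (`d u₁ = u₂ ^ 3`), `u³ = (u₁³, u₂³)` lies in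
`K^×∂(F^×)` (witness `a = 1`, `f = u₁`). -/
theorem cube_mem_of_rel {u₁ : F} {u₂ : H} (hrel : d u₁ = u₂ ^ 3) :
    ∃ (a : A) (f : F), u₁ ^ 3 = ιF a * f ^ 3 ∧ u₂ ^ 3 = ιH a * d f :=
  ⟨1, u₁, by rw [map_one, one_mul], by rw [map_one, one_mul, hrel]⟩

end Summit.BirchSwinnertonDyer.Rank1Residual.SecondDescent.CubeRootMembership
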